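import Summits.Ventures.Crystal3D.Theorems.StickyWulffConstantCoaxialWallLawPayerUnion
import Summits.Ventures.Crystal3D.Theorems.StickyWulffConstantCoaxialWallLawPayerTransMulti
import HarnessLib

/-!
# Incoherent translation offsets (class (A) of the skew trichotomy): the two grains NEVER TOUCH

HONEST FRAMING. Part of the venture `Summits/Ventures/Crystal3D` (cell `crystal3d-full`), helper
`--supports` the crux `CoaxialWallLaw` (stmt-Ventures-19481, `route-Ventures-StickyWulffConstant`),
REGISTERED line `WallLedgerF` (planner cf-p1), open stub `stub_coaxialTwoSlabAdhesion`.  Rung credit only;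
pure lattice arithmetic plus one orientation lemma; F-C1 not moved.

Class (A) of `real_skew_trichotomy` / `skew_trichotomy_fin` (`…SkewArithmetic`, `…Union`) for a translation
offset `τ = A₁⁻¹(t₂ − t₁) ∉ Λ₀` — all six `p_i ± p_j ∈ ℤ`, `p = √2 · cubicCoords τ` — consists of the
OCTAHEDRAL-hole cosets (`p` integral with odd coordinate sum) and the TETRAHEDRAL-hole cosets (`p` half-odd in
every coordinate).  Neither coset contains a UNIT vector: `|P|² = 2` is impossible for an odd-sum integer triple
(`{±1, ±1, 0}` has even sum) and for a half-odd triple (`4|P|²` would be a sum of three odd squares `≡ 3 (mod 8)`).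
Hence (memo HOME/wall-19481-p2/F-TWOPLATE-g5.md §3):

* `allInt_norm_add_ne_one` — class (A), `τ ∉ Λ₀` ⇒ `‖q + τ‖ ≠ 1` for every `q ∈ Λ₀`;
* `movedFcc_dist_ne_one_of_coset` — consequently NO ball of `A·Λ₀ + t₁` is at distance `1` from a ball of
  `A·Λ₀ + t₂`: an INCOHERENT translation pair has no cross contacts at all (contrast: in classes (B)/(C) `τ` is a
  `{111}` fault vector and coherent terraces are free);
* `offset_notMem_of_norm_add_ne_one` — the hypothesis implies `τ ∉ Λ₀`;
* `two_phi_ge_one` — for every orientation `2φ₁ = √2·Σ_{rising}(A r)₂ ≥ 1` (the steepest slot,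
  `exists_slot_rise_ge`), the crude bound that makes the rigid class-(A) rung of `…IncoherentRigid` exceed `½`.

WHAT THIS IS NOT: anything about fillings; F-C1 not moved.
-/

noncomputable section

namespace Summit.Ventures.Crystal3D.Theorems

open Summit.Ventures.Crystal3D Finset NearIdentity
open Literature.MathematicalPhysics.StatisticalMechanics (fccStacking)
open scoped InnerProductSpace

/-- Integers with `a² + b² + c² = 2` have an even sum. -/
theorem even_sum_of_sq_sum_eq_two {a b c : ℤ} (h : a ^ 2 + b ^ 2 + c ^ 2 = 2) : Even (a + b + c) := by
  have ha : a ≤ 1 ∧ -1 ≤ a := by constructor <;> nlinarith [sq_nonneg b, sq_nonneg c, sq_nonneg (a - 1), sq_nonneg (a + 1)]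
  have hb : b ≤ 1 ∧ -1 ≤ b := by constructor <;> nlinarith [sq_nonneg a, sq_nonneg c, sq_nonneg (b - 1), sq_nonneg (b + 1)]
  have hc : c ≤ 1 ∧ -1 ≤ c := by constructor <;> nlinarith [sq_nonneg a, sq_nonneg b, sq_nonneg (c - 1), sq_nonneg (c + 1)]
  obtain ⟨ha1, ha2⟩ := ha
  obtain ⟨hb1, hb2⟩ := hb
  obtain ⟨hc1, hc2⟩ := hc
  rw [Int.even_iff]
  rw [pow_two, pow_two, pow_two] at h
  interval_cases a <;> interval_cases b <;> interval_cases c <;> omega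

/-- Three odd integers never have squares summing to `8`. -/
theorem odd_sq_sum_ne_eight {a b c : ℤ} (ha : Odd a) (hb : Odd b) (hc : Odd c) : a ^ 2 + b ^ 2 + c ^ 2 ≠ 8 := by
  intro h
  have h1 : ∀ m : ℤ, Odd m → 1 ≤ m ^ 2 := by
    intro m hm
    have hm0 : m ≠ 0 := by rintro rfl; exact (Int.not_odd_iff_even.2 (by decide)) hm
    have := Int.one_le_abs hm0
    nlinarith [abs_mul_abs_self m, abs_nonneg m]
  have hab : a ≤ 2 ∧ -2 ≤ a := by constructor <;> nlinarith [h1 b hb, h1 c hc, sq_nonneg (a - 2), sq_nonneg (a + 2)]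
  have hbb : b ≤ 2 ∧ -2 ≤ b := by constructor <;> nlinarith [h1 a ha, h1 c hc, sq_nonneg (b - 2), sq_nonneg (b + 2)]
  have hcb : c ≤ 2 ∧ -2 ≤ c := by constructor <;> nlinarith [h1 a ha, h1 b hb, sq_nonneg (c - 2), sq_nonneg (c + 2)]
  obtain ⟨ka, rfl⟩ := ha
  obtain ⟨kb, rfl⟩ := hb
  obtain ⟨kc, rfl⟩ := hc
  have hka : ka = 0 ∨ ka = -1 := by omega
  have hkb : kb = 0 ∨ kb = -1 := by omega
  have hkc : kc = 0 ∨ kc = -1 := by omega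
  rw [pow_two, pow_two, pow_two] at h
  rcases hka with rfl | rfl <;> rcases hkb with rfl | rfl <;> rcases hkc with rfl | rfl <;> omega

/-- **Class (A) offsets carry no unit vector.**  If all six `p_i ± p_j` (`p = √2 · cubicCoords τ`) are integers
and `τ ∉ Λ₀`, then `‖q + τ‖ ≠ 1` for every `q ∈ Λ₀`. -/
theorem allInt_norm_add_ne_one (τ : EuclideanSpace ℝ (Fin 3))
    (hall : ∀ i j : Fin 3, i ≠ j →
      (∃ z : ℤ, Real.sqrt 2 * cubicCoords τ i + Real.sqrt 2 * cubicCoords τ j = z) ∧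
      (∃ z : ℤ, Real.sqrt 2 * cubicCoords τ i - Real.sqrt 2 * cubicCoords τ j = z))
    (hτ : τ ∉ fccStacking 1 (Real.sqrt (2 / 3))) :
    ∀ q ∈ fccStacking 1 (Real.sqrt (2 / 3)), ‖q + τ‖ ≠ 1 := by
  intro q hq hnorm
  have hs2 : Real.sqrt 2 ^ 2 = 2 := Real.sq_sqrt (by norm_num)
  -- the cubic coordinates of `q + τ` have squares summing to `2` (after scaling by `√2`)
  have hsum : (Real.sqrt 2 * cubicCoords (q + τ) 0) ^ 2 + (Real.sqrt 2 * cubicCoords (q + τ) 1) ^ 2 +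
      (Real.sqrt 2 * cubicCoords (q + τ) 2) ^ 2 = 2 := by
    have h := norm_sq_eq_cubicCoords_sum (q + τ)
    rw [hnorm, one_pow] at h
    nlinarith [h, hs2]
  obtain ⟨a, b, c, habc, ha, hb, hc⟩ := exists_even_cubic_of_mem_fcc hq
  have hP : ∀ i : Fin 3, Real.sqrt 2 * cubicCoords (q + τ) i = Real.sqrt 2 * cubicCoords q i + Real.sqrt 2 * cubicCoords τ i := by
    intro i; rw [cubicCoords_add]; simp only [Pi.add_apply]; ring
  -- `2 p_i ∈ ℤ` and `p_i − p_j ∈ ℤ`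
  have htwo : ∀ i : Fin 3, ∃ w : ℤ, 2 * (Real.sqrt 2 * cubicCoords τ i) = w := by
    intro i
    obtain ⟨j, hij⟩ : ∃ j : Fin 3, i ≠ j := ⟨i + 1, by fin_cases i <;> decide⟩
    obtain ⟨⟨z, hz⟩, ⟨z', hz'⟩⟩ := hall i j hij
    exact ⟨z + z', by push_cast; linarith⟩
  obtain ⟨w0, hw0⟩ := htwo 0
  obtain ⟨w1, hw1⟩ := htwo 1
  obtain ⟨w2, hw2⟩ := htwo 2
  obtain ⟨-, ⟨d01, hd01⟩⟩ := hall 0 1 (by decide)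
  obtain ⟨-, ⟨d02, hd02⟩⟩ := hall 0 2 (by decide)
  -- parities of `w_i` agree: `w_i − w_j = 2 (p_i − p_j)`
  have hpar01 : w0 - w1 = 2 * d01 := by
    have : ((w0 - w1 : ℤ) : ℝ) = ((2 * d01 : ℤ) : ℝ) := by push_cast; linarith
    exact_mod_cast this
  have hpar02 : w0 - w2 = 2 * d02 := by
    have : ((w0 - w2 : ℤ) : ℝ) = ((2 * d02 : ℤ) : ℝ) := by push_cast; linarith
    exact_mod_cast this
  -- the scaled coordinates `P_i = a_i + p_i` with `2 P_i = 2 a_i + w_i`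
  set P0 : ℝ := Real.sqrt 2 * cubicCoords (q + τ) 0 with hP0
  set P1 : ℝ := Real.sqrt 2 * cubicCoords (q + τ) 1 with hP1
  set P2 : ℝ := Real.sqrt 2 * cubicCoords (q + τ) 2 with hP2
  have e0 : 2 * P0 = ((2 * a + w0 : ℤ) : ℝ) := by rw [hP0, hP 0, ha]; push_cast; linarith
  have e1 : 2 * P1 = ((2 * b + w1 : ℤ) : ℝ) := by rw [hP1, hP 1, hb]; push_cast; linarith
  have e2 : 2 * P2 = ((2 * c + w2 : ℤ) : ℝ) := by rw [hP2, hP 2, hc]; push_cast; linarith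
  have hsum4 : (2 * a + w0) ^ 2 + (2 * b + w1) ^ 2 + (2 * c + w2) ^ 2 = (8 : ℤ) := by
    have : (((2 * a + w0) ^ 2 + (2 * b + w1) ^ 2 + (2 * c + w2) ^ 2 : ℤ) : ℝ) = ((8 : ℤ) : ℝ) := by
      push_cast at e0 e1 e2 ⊢
      rw [← e0, ← e1, ← e2]; nlinarith [hsum]
    exact_mod_cast this
  rcases Int.even_or_odd w0 with hev | hodd
  · -- all `w_i` even: `p_i = u_i ∈ ℤ` with odd sum (else `τ ∈ Λ₀`); then `P` is an odd-sum integer triple with `|P|² = 2`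
    obtain ⟨u0, hu0⟩ := hev
    have hev1 : Even w1 := by
      have : w1 = w0 - 2 * d01 := by omega
      rw [this, hu0]; exact ⟨u0 - d01, by ring⟩
    have hev2 : Even w2 := by
      have : w2 = w0 - 2 * d02 := by omega
      rw [this, hu0]; exact ⟨u0 - d02, by ring⟩
    obtain ⟨u1, hu1⟩ := hev1
    obtain ⟨u2, hu2⟩ := hev2
    have hτ0 : Real.sqrt 2 * cubicCoords τ 0 = u0 := by
      have : (2 : ℝ) * (Real.sqrt 2 * cubicCoords τ 0) = 2 * u0 := by rw [hw0, hu0]; push_cast; ring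
      linarith
    have hτ1 : Real.sqrt 2 * cubicCoords τ 1 = u1 := by
      have : (2 : ℝ) * (Real.sqrt 2 * cubicCoords τ 1) = 2 * u1 := by rw [hw1, hu1]; push_cast; ring
      linarith
    have hτ2 : Real.sqrt 2 * cubicCoords τ 2 = u2 := by
      have : (2 : ℝ) * (Real.sqrt 2 * cubicCoords τ 2) = 2 * u2 := by rw [hw2, hu2]; push_cast; ring
      linarith
    have hodd : ¬ Even (u0 + u1 + u2) := fun h => hτ (mem_fcc_of_even_cubic u0 u1 u2 h hτ0 hτ1 hτ2)
    -- the integer triple `a_i + u_i`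
    have hsq : (a + u0) ^ 2 + (b + u1) ^ 2 + (c + u2) ^ 2 = 2 := by
      have h4 : (2 * (a + u0)) ^ 2 + (2 * (b + u1)) ^ 2 + (2 * (c + u2)) ^ 2 = 8 := by
        have e : 2 * a + w0 = 2 * (a + u0) ∧ 2 * b + w1 = 2 * (b + u1) ∧ 2 * c + w2 = 2 * (c + u2) := by
          refine ⟨?_, ?_, ?_⟩ <;> omega
        rw [← e.1, ← e.2.1, ← e.2.2]; exact hsum4
      nlinarith [h4]
    have heven := even_sum_of_sq_sum_eq_two hsq
    apply hodd
    have e : u0 + u1 + u2 = (a + u0 + (b + u1) + (c + u2)) - (a + b + c) := by ring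
    rw [e]
    exact Int.even_sub.2 (iff_of_true heven habc)
  · -- all `w_i` odd: `2P_i` odd with squares summing to `8`
    have hodd1 : Odd w1 := by
      have : w1 = w0 - 2 * d01 := by omega
      rw [this]; exact Int.odd_sub.2 (iff_of_true hodd (even_two_mul d01))
    have hodd2 : Odd w2 := by
      have : w2 = w0 - 2 * d02 := by omega
      rw [this]; exact Int.odd_sub.2 (iff_of_true hodd (even_two_mul d02))
    have o0 : Odd (2 * a + w0) := Int.odd_add.2 (iff_of_false (Int.not_odd_iff_even.2 ⟨a, by ring⟩) (by simpa using hodd))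
    have o1 : Odd (2 * b + w1) := Int.odd_add.2 (iff_of_false (Int.not_odd_iff_even.2 ⟨b, by ring⟩) (by simpa using hodd1))
    have o2 : Odd (2 * c + w2) := Int.odd_add.2 (iff_of_false (Int.not_odd_iff_even.2 ⟨c, by ring⟩) (by simpa using hodd2))
    exact odd_sq_sum_ne_eight o0 o1 o2 hsum4

/-- The no-unit-vector hypothesis forces `τ ∉ Λ₀` (take `q = s − τ` for a slot `s`). -/
theorem offset_notMem_of_norm_add_ne_one {τ : EuclideanSpace ℝ (Fin 3)}
    (hA : ∀ q ∈ fccStacking 1 (Real.sqrt (2 / 3)), ‖q + τ‖ ≠ 1) : τ ∉ fccStacking 1 (Real.sqrt (2 / 3)) := by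
  intro hτ
  obtain ⟨s, hs⟩ : ∃ s, s ∈ fccSlots := ⟨slotSite 0, slotSite_mem 0⟩
  refine hA (s - τ) (fcc_sub_site_mem (mem_fcc_of_mem_fccSlots hs) hτ) ?_
  rw [sub_add_cancel, norm_eq_one_of_mem_fccSlots hs]

/-- **Incoherent translation pairs have no cross contacts.**  If `‖q + A⁻¹(t₂ − t₁)‖ ≠ 1` for all `q ∈ Λ₀`,
then no point of `A·Λ₀ + t₁` is at distance `1` from a point of `A·Λ₀ + t₂`. -/
theorem movedFcc_dist_ne_one_of_coset (A : EuclideanSpace ℝ (Fin 3) ≃ₗᵢ[ℝ] EuclideanSpace ℝ (Fin 3))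
    (t₁ t₂ : EuclideanSpace ℝ (Fin 3))
    (hA : ∀ q ∈ fccStacking 1 (Real.sqrt (2 / 3)), ‖q + A.symm (t₂ - t₁)‖ ≠ 1)
    {x y : EuclideanSpace ℝ (Fin 3)}
    (hx : x ∈ (fun q => A q + t₁) '' fccStacking 1 (Real.sqrt (2 / 3)))
    (hy : y ∈ (fun q => A q + t₂) '' fccStacking 1 (Real.sqrt (2 / 3))) : dist x y ≠ 1 := by
  obtain ⟨q₁, hq₁, rfl⟩ := hx
  obtain ⟨q₂, hq₂, rfl⟩ := hy
  intro hd
  apply hA (q₂ - q₁) (fcc_sub_site_mem hq₂ hq₁)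
  have e : A q₂ + t₂ - (A q₁ + t₁) = A (q₂ - q₁ + A.symm (t₂ - t₁)) := by
    rw [map_add, map_sub, A.apply_symm_apply]; abel
  rw [dist_comm, dist_eq_norm, e, LinearIsometryEquiv.norm_map] at hd
  exact hd

/-- Points of the two cosets are distinct. -/
theorem movedFcc_ne_of_coset (A : EuclideanSpace ℝ (Fin 3) ≃ₗᵢ[ℝ] EuclideanSpace ℝ (Fin 3))
    (t₁ t₂ : EuclideanSpace ℝ (Fin 3))
    (hA : ∀ q ∈ fccStacking 1 (Real.sqrt (2 / 3)), ‖q + A.symm (t₂ - t₁)‖ ≠ 1)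
    {x y : EuclideanSpace ℝ (Fin 3)}
    (hx : x ∈ (fun q => A q + t₁) '' fccStacking 1 (Real.sqrt (2 / 3)))
    (hy : y ∈ (fun q => A q + t₂) '' fccStacking 1 (Real.sqrt (2 / 3))) : x ≠ y := by
  obtain ⟨q₁, hq₁, rfl⟩ := hx
  obtain ⟨q₂, hq₂, rfl⟩ := hy
  intro h
  apply offset_notMem_of_norm_add_ne_one hA
  have e : A.symm (t₂ - t₁) = q₁ - q₂ := by
    apply A.injective
    rw [A.apply_symm_apply, map_sub, sub_eq_sub_iff_add_eq_add, add_comm]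
    exact h.symm
  rw [e]; exact fcc_sub_site_mem hq₁ hq₂

/-- **`2φ₁ ≥ 1` for every orientation** (the steepest slot rises `≥ 1/√2`). -/
theorem two_phi_ge_one (A : EuclideanSpace ℝ (Fin 3) ≃ₗᵢ[ℝ] EuclideanSpace ℝ (Fin 3)) :
    1 ≤ 2 * (Real.sqrt 2 / 4 * ∑ᶠ w ∈ {w ∈ fccStacking 1 (Real.sqrt (2 / 3)) | ‖w‖ = 1},
      |⟪w, A.symm (EuclideanSpace.single (2 : Fin 3) (1 : ℝ))⟫_ℝ|) := by
  classical
  rw [← sqrt_two_mul_sum_rising_eq_two_phi A]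
  obtain ⟨u, hu, hrise⟩ := exists_slot_rise_ge A
  have hs2 : 0 < Real.sqrt 2 := by positivity
  have hpos : 0 < (A u) 2 := lt_of_lt_of_le (by positivity) hrise
  have hmem : u ∈ fccSlots.filter (fun r => 0 < (A r) 2) := mem_filter.2 ⟨hu, hpos⟩
  have hle : (A u) 2 ≤ ∑ r ∈ fccSlots.filter (fun r => 0 < (A r) 2), (A r) 2 :=
    single_le_sum (f := fun r => (A r) 2) (fun r hr => (mem_filter.1 hr).2.le) hmem
  have h1 : 1 ≤ Real.sqrt 2 * (A u) 2 := by
    have := mul_le_mul_of_nonneg_left hrise hs2.le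
    rw [mul_one_div, div_self hs2.ne'] at this
    exact this
  nlinarith [hle, h1, hs2]

end Summit.Ventures.Crystal3D.Theorems

end
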